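/-
Origin: expansion seat `planner-pub-hodgecm-pv02-g3-0`, handover #9 2026-08-18T06:18:19Z (`HOME/pub-hodgecm-pv02-g3/lean/Pv02g3/PerL34/SplitHolFormulas.lean`, md5 4268fefd, 72 lines);
landed by the gen-6 packager in gate run 24 as `HodgeCM/PerL34/SplitHolFormulas.lean` (import ^import Pv[0-9]+g[0-9]+\.PerL34\.→import HodgeCM.PerL34. ×1; stripped 1 #print/#check/#eval lines).
-/
/-
Origin: planner-pub-hodgecm-pv02-g3-0 (unit pub-hodgecm-pv02-g3, DAG-NODE PROVER #02 gen 3), 2026-08-18.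
Proposed tree path: `HodgeCM/PerL34/SplitHolFormulas.lean` (new, additive).  Imports my `SplitHolForms` (run-24 queue).
KERNEL: nothing cited, nothing asserted.
-/
import Summits.HodgeConjecture.HodgeCM.PerL34.SplitHolForms

/-!
# Explicit formulas for the two orbit families of `SplitHolForms` (first steps towards `OrbitSpansDisjoint`)

With `w = W3 s x = mat s *ᵥ (x₀, x₁, 1)` (rows `N₀ = w 0`, `N₁ = w 1`, `ℓ = w 2`, affine in `x`):

* `push_dz0_apply`   : `push s dz0 x j    = (s₀ⱼ ℓ − N₀ s₂ⱼ) / ℓ²`  — i.e. `push s dz0 = (ℓ dN₀ − N₀ dℓ)/ℓ² = d(N₀/ℓ)`;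
* `push_omega0_apply`: `push s omega0 x j = (N₀ s₁ⱼ − N₁ s₀ⱼ) / ℓ²`  — i.e. `push s ω₀ = (N₀ dN₁ − N₁ dN₀)/ℓ²`
  (the `ℓ⁻³` terms cancel).

So both families consist of forms `W(f,g)/ℓ²`, `W(f,g) := f dg − g df` with AFFINE coefficients, the `dz0`-family with
`(f,g) = (ℓ, N₀)` (the denominator's own row) and the `ω₀`-family with `(f,g) = (N₀, N₁)` (the two other rows).  The
residual `OrbitSpansDisjoint` is the partial-fraction uniqueness for such forms (see `HOME/pub-hodgecm-pv02-g3/HANDOFF.md`,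
"How to discharge `OrbitSpansDisjoint`").
-/

noncomputable section

open Complex Matrix

namespace HodgeCM
namespace PerL34
namespace SplitHolForms

open HodgeCM.PerL34.BallModel HodgeCM.PerL34.BallSpans

/-- Entry formula of the transposed Jacobian applied to a vector. -/
theorem transpose_Jac_mulVec (s : U21) (x : Ball) (v : Fin 2 → ℂ) (j : Fin 2) :
    ((Jac s x)ᵀ *ᵥ v) j = Jac s x 0 j * v 0 + Jac s x 1 j * v 1 := by
  simp [Matrix.mulVec, dotProduct, Fin.sum_univ_two, Matrix.transpose_apply]

/-- (Ported verbatim from the HodgeCMPerL package; no docstring in the source.) -/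
theorem Jac_apply (s : U21) (x : Ball) (i j : Fin 2) :
    Jac s x i j = (mat s (Fin.castSucc i) (Fin.castSucc j) * W3 s x 2 -
      W3 s x (Fin.castSucc i) * mat s 2 (Fin.castSucc j)) / W3 s x 2 ^ 2 := rfl

/-- `push s dz0 = d(N₀/ℓ)`: coefficient `j` is `(s₀ⱼ ℓ − N₀ s₂ⱼ)/ℓ²`. -/
theorem push_dz0_apply (s : U21) (x : Ball) (j : Fin 2) :
    push s dz0 x j = (mat s 0 (Fin.castSucc j) * W3 s x 2 - W3 s x 0 * mat s 2 (Fin.castSucc j)) / W3 s x 2 ^ 2 := by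
  rw [push_apply, transpose_Jac_mulVec]
  simp [dz0, Jac_apply]

/-- `push s ω₀ = (N₀ dN₁ − N₁ dN₀)/ℓ²`: coefficient `j` is `(N₀ s₁ⱼ − N₁ s₀ⱼ)/ℓ²`. -/
theorem push_omega0_apply (s : U21) (x : Ball) (j : Fin 2) :
    push s omega0 x j = (W3 s x 0 * mat s 1 (Fin.castSucc j) - W3 s x 1 * mat s 0 (Fin.castSucc j)) / W3 s x 2 ^ 2 := by
  have h2 : W3 s x 2 ≠ 0 := W3_2_ne_zero s x
  rw [push_apply, transpose_Jac_mulVec]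
  have h0 : omega0 (s • x) 0 = -(W3 s x 1 / W3 s x 2) := by
    simp [omega0, smul_val]
  have h1 : omega0 (s • x) 1 = W3 s x 0 / W3 s x 2 := by
    simp [omega0, smul_val]
  rw [h0, h1, Jac_apply, Jac_apply]
  simp only [Fin.castSucc_zero, Fin.castSucc_one]
  field_simp
  ring

/-- The numerators are AFFINE: `W3 s x k = s_k0 x₀ + s_k1 x₁ + s_k2` (re-export of `W3_apply` for the reader). -/
theorem W3_affine (s : U21) (x : Ball) (k : Fin 3) :
    W3 s x k = mat s k 0 * x.1 0 + mat s k 1 * x.1 1 + mat s k 2 := W3_apply s x k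

end SplitHolForms
end PerL34
end HodgeCM

end

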